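import Literature.Topology.FourManifolds.KirbyMovesSlideModel
import Literature.Topology.FourManifolds.KnotReparametrisation
import Literature.Topology.FourManifolds.GluingUniqueness
import Literature.Topology.FourManifolds.CircleSurgeryExistence
import Literature.Topology.FourManifolds.KirbyMovesShrinkProofs
import HarnessLib

/-!
# Transport tools for the slide diffeomorphism (S₁): supported reparametrisation, pushing diffeomorphisms of `S³` into a surgery, the surgered tube

Topic `Literature/Topology/FourManifolds`; fact seat
`provefact-Literature.Topology.FourManifolds.Framed-8b2614fcc9`. Infrastructure for the slide
diffeomorphism of the surgered manifold `Yⱼ = ∂(B⁴ ∪ hⱼ)` of a handle slide (R. C. Kirby, *The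
Topology of 4-Manifolds* (1989), Ch. I §4), i.e. for a direct proof of the slide model (S)
`Literature.Topology.FourManifolds.FramedLink.IsStrictHandleSlide.slideModel`
(`KirbyMovesHandleSlide.lean`). (Written for the former split (S₁) of (S), the "slide
diffeomorphism" named fact of `KirbyMovesSlideModel.lean`; that split was refuted as typed over
the tree's corner-free band data and retired — its per-datum form is the predicate
`Literature.Topology.FourManifolds.FramedLink.IsStrictHandleSlide.SlideDiffeoFor`, its negation the
theorem `FramedLink.IsStrictHandleSlide.not_slideDiffeo` of `KirbyMovesSlideModelRefutation.lean` —
and the tools below serve (S) unchanged.) Everything here is proved; no named fact is introduced. The slide diffeomorphism is assembled from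
isotopies of `S³` supported away from the surgery tube (finger move along the band,
reparametrisation of the slid circle) and one isotopy of the new solid torus region (the sweep
across the meridian disc); this file provides the plumbing which moves such maps between `S³`
and `Yⱼ`, for a surgery `Yⱼ` on a knot `K` presented by gluing maps `φ : S³ ∖ K → Yⱼ`,
`ψ : D̊² × S¹ → Yⱼ` along the tube `νⱼ` (`surgeryRel νⱼ`, `DehnSurgery.lean`):

* `Literature.Topology.FourManifolds.Knot.exists_ambientIsotopy_comp_eq_supported` — **supported
  reparametrisation**: knots with the same oriented image are related by an ambient isotopy of
  `S³` supported in any neighbourhood of the image (the tree's `Knot.isIsotopic_of_range_eq_holds`,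
  `KnotReparametrisation.lean`, with the tube of the twist isotopy chosen inside the
  neighbourhood; Hirsch (1976), Ch. 8 §1, Thm. 1.3).
* `Literature.Topology.FourManifolds.exists_diffeomorph_push` — **a diffeomorphism `G` of `S³`
  which is the identity on the open unit tube of `νⱼ` induces a diffeomorphism `Ĝ` of `Yⱼ`** with
  `Ĝ ∘ φ = φ ∘ G`, `Ĝ ∘ ψ = ψ` (comparison map of the gluing twisted by `G`; Kosinski (1993),
  Ch. VI §1); with `complDiffeoOfFixTube` (restriction of `G` to `S³ ∖ K`).
* `Literature.Topology.FourManifolds.exists_surgeredTube` — **the surgered tube**: the new open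
  solid torus `ψ(D̊² × S¹)` and the punctured old tube `φ(νⱼ(S¹ × (ℝ² ∖ 0)))` form one tube
  `Ψ : S¹ × ℝ² ↪ Yⱼ` (`TubeNbhd`, `TubeSurgery.lean`) around the core `v ↦ ψ (0, v)` of the new solid
  torus, with `Ψ (v, p) = ψ (p, v)` (`‖p‖ < 1`) and `Ψ (w/‖w‖, ‖w‖ x) = φ (νⱼ (x, w))` (`w ≠ 0`):
  global coordinates in which every longitude `νⱼ (S¹ × {w})` of the old tube bounds the flat
  meridian disc `Ψ (D̄²_{‖w‖} × {w/‖w‖})` — the disc `Δ` across which the slide sweeps — and along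
  which compactly supported isotopies of `S¹ × ℝ²` are pushed into `Yⱼ`
  (`TubeNbhd.tubeIsotopyPush`, `TubeIsotopyPushforward.lean`). Construction: `S¹ × ℝ²` (realised as
  the image of `νⱼ` in `S³`, so that both sides are modelled on `ℝ³`) and the open subset
  `ψ(D̊² × S¹) ∪ φ(νⱼ(S¹ × (ℝ² ∖ 0)))` of `Yⱼ` are open gluings of the punctured bundle
  `S¹ × (ℝ² ∖ 0)` and the open solid torus along the same relation — via the **polar swap**
  `(x, w) ↦ (w/‖w‖, ‖w‖ x)` (`polarSwap`, an involutive diffeomorphism of the punctured bundle) —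
  hence diffeomorphic compatibly with the pieces (`exists_diffeomorph_comp_eq_of_gluings`,
  `KirbyMovesBlowDown.lean`).
* `Literature.Topology.FourManifolds.exists_presentation_scale` — shrinking the solid torus
  (tube `νⱼ.scale r`, solid torus `ψ ∘ (p, v) ↦ (r p, v)`) **keeps `φ`** (single-knot form of
  `Link.IsSurgeryPresentation.scale`, `KirbyMovesShrinkProofs.lean`);
  `Literature.Topology.FourManifolds.exists_presentation_conj` — conjugating `φ` by a
  diffeomorphism `F` of `S³` fixing `K` with `F ∘ ν₂ = ν₁` on the unit tube re-presents the
  surgery with the tube `ν₂` (as in `IsIntegralSurgery.exists_presentation'`,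
  `KirbyMovesFromModels.lean`, keeping track of `F`). Together with the proved framed uniqueness
  of tubes (`Knot.TubularNbhd.framedUniqueness_holds`) these align the tube of a presentation of
  `Yⱼ` with (a rescaling of) the tube `ν` of the slide datum, by a diffeomorphism supported in a
  thin tube around `Kⱼ`.

## References

* R. C. Kirby, *The Topology of 4-Manifolds*, LNM 1374, Springer (1989), Ch. I §4 (handle
  slides). [cite: Kirby1989, Ch. I §4]
* A. Kosinski, *Differential Manifolds*, Academic Press (1993), Ch. VI §1, proof of Thm. (1.1)
  (uniqueness of gluings; the comparison map). [cite: Kosinski1993, Ch. VI §1, proof of Thm (1.1)]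
* D. Rolfsen, *Knots and Links* (1976), §9.F (Dehn surgery along a solid torus; the new solid
  torus and its meridian discs). [cite: Rolfsen1976, §9.F]
* M. W. Hirsch, *Differential Topology* (1976), Ch. 8 §1, Thm. 1.3 (isotopy extension with
  support). [cite: HirschDT1976, Ch. 8 §1, Thm. 1.3]

## Design notes

* Auxiliary definitions: `complDiffeoOfFixTube`, `puncturedBundle`, `polarSwapFun`, `polarSwap`;
  everything else is a theorem; no `sorry`; no statement of another file is modified.
* `exists_surgeredTube` is stated for any presentation tube `μ`; for the slide one first aligns
  `μ` with `ν.scale s` (small `s`), so that in the coordinates `Ψ` the push-off `ν.pushOff` is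
  the circle of radius `1/(2s)` in a slice and the collar `ν.collar` its punctured disc.
-/

open scoped Manifold ContDiff Topology
open Function Set

noncomputable section

namespace Literature.Topology.FourManifolds

/-- Local notation: `𝔼 n` is the model Euclidean space `EuclideanSpace ℝ (Fin n)`. -/
local notation "𝔼 " n:arg => EuclideanSpace ℝ (Fin n)

/-- Local notation: `𝕊 n` is the unit sphere in `EuclideanSpace ℝ (Fin (n + 1))`. -/
local notation "𝕊 " n:arg => (Metric.sphere (0 : EuclideanSpace ℝ (Fin (n + 1))) 1)

attribute [local instance] fact_finrank_euclideanSpace_succ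

/-! ## Supported reparametrisation of a knot -/

namespace Knot

/-- **Reparametrising a knot by an ambient isotopy supported near the knot.** If the knots
`K`, `K'` have the same image and induce the same orientation on it, then for every open
`V ⊇ K(S¹)` there is an ambient isotopy `F` of `S³` with `F 1 ∘ K = K'`, all of whose stages are
the identity off `V`: the reparametrisation `ρ = K⁻¹ ∘ K'` has degree one
(`hasDegreeOne_reparam`), is the end of a diffeotopy of the circle, and the knot slides along
itself inside a tubular neighbourhood chosen inside `V` (`Knot.exists_tubularNbhd_range_subset`,
`twistIsotopy`, which is the identity off the tube). Hirsch, *Differential Topology* (1976),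
Ch. 8 §1, Thm. 1.3 (isotopy extension with compact support in a prescribed open set).
[cite: HirschDT1976, Ch. 8 §1, Thm. 1.3] -/
theorem exists_ambientIsotopy_comp_eq_supported (K K' : Knot) (hrange : range ⇑K = range ⇑K')
    (hor : SameOrientationAt K K') {V : Set (𝕊 3)} (hV : IsOpen V) (hKV : range ⇑K ⊆ V) :
    ∃ F : AmbientIsotopy (𝓡 3) (𝕊 3), F.toFun 1 ∘ ⇑K = ⇑K' ∧
      ∀ (t : ℝ) (y : 𝕊 3), y ∉ V → F.toFun t y = y := by
  set φ := SphereEmbedding.reparam K K' hrange with hφdef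
  obtain ⟨Φ, hΦc, hlift, hper⟩ := hasDegreeOne_reparam K K' hrange hor
  have h := isPosLift_of_lift φ hΦc hlift hper
  obtain ⟨ν, hν⟩ := K.exists_tubularNbhd_range_subset hV hKV
  refine ⟨twistIsotopy ν h.ambientIsotopy.toDiffeotopy, ?_, fun t y hy ↦ ?_⟩
  · have : (twistIsotopy ν h.ambientIsotopy.toDiffeotopy).toFun 1 ∘ ⇑K = ⇑K ∘ ⇑φ := by
      funext x
      rw [comp_apply, comp_apply, twistIsotopy_apply, AmbientIsotopy.toDiffeotopy_toFun,
        h.ambientIsotopy_toFun_one, circleDescend_eq_of_lift hlift]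
    exact this.trans (SphereEmbedding.comp_reparam K K' hrange)
  · exact twistIsotopy_apply_of_not_mem ν _ t fun hy' ↦ hy (hν hy')

end Knot

/-! ## Pushing a diffeomorphism of `S³` fixing the unit tube into the surgered manifold -/

section Push

variable {K : Knot} (νⱼ : Knot.TubularNbhd K)
  {Yⱼ : Type*} [TopologicalSpace Yⱼ] [ChartedSpace (𝔼 3) Yⱼ] [IsManifold (𝓡 3) ∞ Yⱼ]
  (φ : K.complement → Yⱼ) (ψ : solidTorus → Yⱼ)

/-- A diffeomorphism of `S³` which is the identity on the open unit tube of `νⱼ` fixes the knot,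
hence preserves its complement. [folklore] -/
theorem mem_complement_iff_of_fix_tube (G : (𝕊 3) ≃ₘ⟮𝓡 3, 𝓡 3⟯ (𝕊 3))
    (hG : ∀ (x : 𝕊 1) (w : 𝔼 2), ‖w‖ < 1 → G (νⱼ (x, w)) = νⱼ (x, w)) (a : 𝕊 3) :
    a ∈ K.complement ↔ G a ∈ K.complement := by
  have hfix : ∀ x, G (K x) = K x := fun x ↦ by
    rw [← νⱼ.coe_apply_zero x]; exact hG x 0 (by simp)
  simp only [SphereEmbedding.mem_complement_iff, mem_range, not_exists]
  refine forall_congr' fun x ↦ not_congr ⟨fun h ↦ ?_, fun h ↦ ?_⟩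
  · rw [← h, hfix]
  · exact G.injective ((hfix x).trans h)

/-- The restriction to the knot complement of a diffeomorphism of `S³` which is the identity on
the open unit tube of `νⱼ`. [folklore] -/
def complDiffeoOfFixTube (G : (𝕊 3) ≃ₘ⟮𝓡 3, 𝓡 3⟯ (𝕊 3))
    (hG : ∀ (x : 𝕊 1) (w : 𝔼 2), ‖w‖ < 1 → G (νⱼ (x, w)) = νⱼ (x, w)) :
    K.complement ≃ₘ⟮𝓡 3, 𝓡 3⟯ K.complement :=
  G.restrOpens K.complement K.complement (mem_complement_iff_of_fix_tube νⱼ G hG)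

/-- Values of `complDiffeoOfFixTube`. [folklore] -/
@[simp] theorem coe_complDiffeoOfFixTube_apply (G : (𝕊 3) ≃ₘ⟮𝓡 3, 𝓡 3⟯ (𝕊 3))
    (hG : ∀ (x : 𝕊 1) (w : 𝔼 2), ‖w‖ < 1 → G (νⱼ (x, w)) = νⱼ (x, w)) (a : K.complement) :
    ((complDiffeoOfFixTube νⱼ G hG a : K.complement) : 𝕊 3) = G a := rfl

/-- The surgery relation of `νⱼ` is preserved by a diffeomorphism fixing its open unit tube.
[folklore] -/
theorem surgeryRel_complDiffeoOfFixTube_iff (G : (𝕊 3) ≃ₘ⟮𝓡 3, 𝓡 3⟯ (𝕊 3))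
    (hG : ∀ (x : 𝕊 1) (w : 𝔼 2), ‖w‖ < 1 → G (νⱼ (x, w)) = νⱼ (x, w)) (a : K.complement)
    (c : solidTorus) : surgeryRel νⱼ (complDiffeoOfFixTube νⱼ G hG a) c ↔ surgeryRel νⱼ a c := by
  change νⱼ.glueRel (G a) c ↔ νⱼ.glueRel a c
  constructor
  · rintro ⟨u, t, ht, hb, ha⟩
    refine ⟨u, t, ht, hb, G.injective ?_⟩
    change G a = G _
    rw [ha, hG u _ (norm_smul_coe_sphere_lt_one ht _)]
  · rintro ⟨u, t, ht, hb, ha⟩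
    refine ⟨u, t, ht, hb, ?_⟩
    rw [ha, hG u _ (norm_smul_coe_sphere_lt_one ht _)]

variable {νⱼ φ ψ}

/-- **Pushing a diffeomorphism of `S³` fixing the unit tube into the surgered manifold.** Let
`Yⱼ` be presented as surgery on `K` with the tube `νⱼ` by gluing maps `φ : S³ ∖ K → Yⱼ`,
`ψ : D̊² × S¹ → Yⱼ` (open smooth embeddings covering `Yⱼ`, glued along `surgeryRel νⱼ`), and let
`G` be a diffeomorphism of `S³` which is the identity on the open unit tube `νⱼ(S¹ × D̊²)`. Then
there is a diffeomorphism `Ĝ` of `Yⱼ` with `Ĝ ∘ φ = φ ∘ G` and `Ĝ ∘ ψ = ψ`: the comparison map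
of the gluing with itself twisted by `G` on the first piece (Kosinski, *Differential Manifolds*
(1993), Ch. VI §1, proof of Thm. (1.1): `IsOpenGluing.exists_map_apply_eq`,
`IsOpenGluing.contMDiff_of_comp_eq`), with inverse the same for `G⁻¹`. This is the extension by
the identity of a diffeomorphism of the open piece `φ(S³ ∖ K)` supported away from the new solid
torus (Hirsch (1976), Ch. 8 §1). [cite: Kosinski1993, Ch. VI §1, proof of Thm (1.1)] -/
theorem exists_diffeomorph_push (hφ : Manifold.IsSmoothEmbedding (𝓡 3) (𝓡 3) ∞ φ)
    (hφo : IsOpen (range φ))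
    (hψ : Manifold.IsSmoothEmbedding (𝓘(ℝ, 𝔼 2).prod (𝓡 1)) (𝓡 3) ∞ ψ) (hψo : IsOpen (range ψ))
    (hcov : range φ ∪ range ψ = univ) (hrel : ∀ a c, φ a = ψ c ↔ surgeryRel νⱼ a c)
    (G : (𝕊 3) ≃ₘ⟮𝓡 3, 𝓡 3⟯ (𝕊 3))
    (hG : ∀ (x : 𝕊 1) (w : 𝔼 2), ‖w‖ < 1 → G (νⱼ (x, w)) = νⱼ (x, w)) :
    ∃ Ĝ : Yⱼ ≃ₘ⟮𝓡 3, 𝓡 3⟯ Yⱼ, (∀ a, Ĝ (φ a) = φ (complDiffeoOfFixTube νⱼ G hG a)) ∧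
      ∀ c, Ĝ (ψ c) = ψ c := by
  set Gc := complDiffeoOfFixTube νⱼ G hG with hGc
  have hG' : ∀ (x : 𝕊 1) (w : 𝔼 2), ‖w‖ < 1 → G.symm (νⱼ (x, w)) = νⱼ (x, w) := fun x w hw ↦ by
    conv_lhs => rw [← hG x w hw]
    rw [Diffeomorph.symm_apply_apply]
  set Gc' := complDiffeoOfFixTube νⱼ G.symm hG' with hGc'
  have hGcGc' : ∀ a, Gc (Gc' a) = a := fun a ↦ Subtype.ext (G.apply_symm_apply (a : 𝕊 3))
  have hGc'Gc : ∀ a, Gc' (Gc a) = a := fun a ↦ Subtype.ext (G.symm_apply_apply (a : 𝕊 3))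
  have hinjφ := hφ.isEmbedding.injective
  have hinjψ := hψ.isEmbedding.injective
  -- compatibility of the twisted gluing maps
  have hR : ∀ a c, φ a = ψ c → (φ ∘ Gc) a = ψ c := fun a c h ↦ by
    rw [comp_apply, hrel, surgeryRel_complDiffeoOfFixTube_iff]; exact (hrel a c).1 h
  have hR' : ∀ a c, φ a = ψ c → (φ ∘ Gc') a = ψ c := fun a c h ↦ by
    rw [comp_apply, hrel, surgeryRel_complDiffeoOfFixTube_iff]; exact (hrel a c).1 h
  obtain ⟨F, hFA, hFB⟩ := IsOpenGluing.exists_map_apply_eq (jA' := φ ∘ Gc) (jB' := ψ) hcov hinjφ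
    hinjψ hR
  obtain ⟨F', hF'A, hF'B⟩ := IsOpenGluing.exists_map_apply_eq (jA' := φ ∘ Gc') (jB' := ψ) hcov
    hinjφ hinjψ hR'
  have hFc : ContMDiff (𝓡 3) (𝓡 3) ∞ F :=
    IsOpenGluing.contMDiff_of_comp_eq hφ hφo hψ hψo hcov (hφ.contMDiff.comp Gc.contMDiff)
      hψ.contMDiff hFA hFB
  have hF'c : ContMDiff (𝓡 3) (𝓡 3) ∞ F' :=
    IsOpenGluing.contMDiff_of_comp_eq hφ hφo hψ hψo hcov (hφ.contMDiff.comp Gc'.contMDiff)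
      hψ.contMDiff hF'A hF'B
  have hFF' : ∀ y, F (F' y) = y := fun y ↦ by
    rcases (eq_univ_iff_forall.1 hcov y) with ⟨a, rfl⟩ | ⟨c, rfl⟩
    · rw [hF'A, comp_apply, hFA, comp_apply, hGcGc']
    · rw [hF'B, hFB]
  have hF'F : ∀ y, F' (F y) = y := fun y ↦ by
    rcases (eq_univ_iff_forall.1 hcov y) with ⟨a, rfl⟩ | ⟨c, rfl⟩
    · rw [hFA, comp_apply, hF'A, comp_apply, hGc'Gc]
    · rw [hFB, hF'B]
  exact ⟨⟨⟨F, F', hF'F, hFF'⟩, hFc, hF'c⟩, hFA, hFB⟩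

end Push

/-! ## The surgered tube: coordinates `S¹ × ℝ²` on the new solid torus together with the old tube -/

section SurgeredTube

/-- The plane bundle `S¹ × ℝ²` punctured along its zero section, as an open subset. [folklore] -/
def puncturedBundle : TopologicalSpace.Opens ((𝕊 1) × (𝔼 2)) :=
  ⟨{q | q.2 ≠ 0}, isOpen_ne.preimage continuous_snd⟩

/-- Membership in the punctured bundle. [folklore] -/
@[simp] theorem mem_puncturedBundle_iff (q : (𝕊 1) × (𝔼 2)) : q ∈ puncturedBundle ↔ q.2 ≠ 0 :=
  Iff.rfl

/-- **The polar swap** `(x, w) ↦ (w / ‖w‖, ‖w‖ • x)` of the punctured bundle: it exchanges the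
core coordinate and the fibre direction keeping the radius — the coordinate change between the
old tube `ν (x, w)` and the new solid torus `(‖w‖ • x, w / ‖w‖)` of a Dehn surgery. It is the
tree's `TubeNbhd.polar` (`TubeSurgery.lean`) followed by the swap of the factors (and agrees with
`TubeNbhd.polarInv ∘ Prod.swap` definitionally); it is an involution. [folklore] -/
def polarSwapFun (q : (𝕊 1) × (𝔼 2)) : (𝕊 1) × (𝔼 2) := (TubeNbhd.polar q).swap

/-- The polar swap is `TubeNbhd.polarInv` after the swap of the factors. [folklore] -/
theorem polarSwapFun_eq_polarInv_swap (q : (𝕊 1) × (𝔼 2)) :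
    polarSwapFun q = TubeNbhd.polarInv q.swap := rfl

/-- The fibre coordinate of the polar swap has the same norm. [folklore] -/
theorem norm_polarSwapFun_snd (q : (𝕊 1) × (𝔼 2)) : ‖(polarSwapFun q).2‖ = ‖q.2‖ :=
  TubeNbhd.norm_polar_fst q

/-- The fibre coordinate of the polar swap is nonzero off the zero section. [folklore] -/
theorem polarSwapFun_snd_ne_zero {q : (𝕊 1) × (𝔼 2)} (hq : q.2 ≠ 0) : (polarSwapFun q).2 ≠ 0 :=
  norm_ne_zero_iff.1 ((norm_polarSwapFun_snd q).trans_ne (norm_ne_zero_iff.2 hq))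

/-- The polar swap is an involution off the zero section. [folklore] -/
theorem polarSwapFun_polarSwapFun {q : (𝕊 1) × (𝔼 2)} (hq : q.2 ≠ 0) :
    polarSwapFun (polarSwapFun q) = q := by
  rw [polarSwapFun_eq_polarInv_swap, polarSwapFun, Prod.swap_swap]
  exact TubeNbhd.polarInv_polar hq

/-- The polar swap is smooth off the zero section. [folklore] -/
theorem contMDiffOn_polarSwapFun :
    ContMDiffOn ((𝓡 1).prod 𝓘(ℝ, 𝔼 2)) ((𝓡 1).prod 𝓘(ℝ, 𝔼 2)) ∞ polarSwapFun {q | q.2 ≠ 0} :=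
  (contMDiff_snd.prodMk contMDiff_fst).comp_contMDiffOn TubeNbhd.contMDiffOn_polar

/-- The polar swap as a diffeomorphism (an involution) of the punctured bundle. [folklore] -/
def polarSwap : puncturedBundle ≃ₘ⟮(𝓡 1).prod 𝓘(ℝ, 𝔼 2), (𝓡 1).prod 𝓘(ℝ, 𝔼 2)⟯ puncturedBundle where
  toFun q := ⟨polarSwapFun q, polarSwapFun_snd_ne_zero q.2⟩
  invFun q := ⟨polarSwapFun q, polarSwapFun_snd_ne_zero q.2⟩
  left_inv q := Subtype.ext (polarSwapFun_polarSwapFun q.2)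
  right_inv q := Subtype.ext (polarSwapFun_polarSwapFun q.2)
  contMDiff_toFun := (ContMDiff.subtypeVal_comp_iff puncturedBundle _).1
    (contMDiffOn_polarSwapFun.comp_contMDiff contMDiff_subtype_val fun q ↦ q.2)
  contMDiff_invFun := (ContMDiff.subtypeVal_comp_iff puncturedBundle _).1
    (contMDiffOn_polarSwapFun.comp_contMDiff contMDiff_subtype_val fun q ↦ q.2)

/-- Values of `polarSwap`. [folklore] -/
@[simp] theorem coe_polarSwap_apply (q : puncturedBundle) :
    ((polarSwap q : puncturedBundle) : (𝕊 1) × (𝔼 2)) = polarSwapFun q := rfl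

variable {K : Knot} (μ : Knot.TubularNbhd K)
  {Y : Type*} [TopologicalSpace Y] [ChartedSpace (𝔼 3) Y] [IsManifold (𝓡 3) ∞ Y]
  {φ : K.complement → Y} {ψ : solidTorus → Y}

/-- The old tube restricted to the punctured bundle lands in the knot complement. [folklore] -/
theorem Knot.TubularNbhd.apply_mem_complement_of_mem_puncturedBundle (q : puncturedBundle) :
    μ (q : (𝕊 1) × (𝔼 2)) ∈ K.complement :=
  μ.apply_mem_compl_range q.2

/-- **The surgered tube.** Let `Y` be presented as surgery on `K` with the tube `μ` by gluing
maps `φ : S³ ∖ K → Y`, `ψ : D̊² × S¹ → Y` (open smooth embeddings covering `Y`, glued along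
`surgeryRel μ`: `φ (μ (u, t v)) = ψ (t u, v)`, `0 < t < 1`). Then the new open solid torus
`ψ(D̊² × S¹)` and the punctured old tube `φ(μ(S¹ × (ℝ² ∖ 0)))` together form one tube around the
core circle `v ↦ ψ (0, v)` of the new solid torus: there is a tube `Ψ : S¹ × ℝ² ↪ Y` (`TubeNbhd`)
with `Ψ (v, p) = ψ (p, v)` for `‖p‖ < 1` and `Ψ (w / ‖w‖, ‖w‖ • x) = φ (μ (x, w))` for `w ≠ 0` —
the meridian discs `Ψ (D̄²_r × {v})` of the new solid torus of *any* radius `r`, bounded by the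
longitudes `μ (S¹ × {r v})` of the old tube. (Both `S¹ × ℝ²` and the open subset
`ψ(D̊² × S¹) ∪ φ(μ(S¹ × (ℝ² ∖ 0)))` of `Y` are open gluings of the punctured bundle and the open
solid torus along the same relation, hence diffeomorphic compatibly with the pieces: Kosinski,
*Differential Manifolds* (1993), Ch. VI §1, `exists_diffeomorph_comp_eq_of_gluings`.) Rolfsen,
*Knots and Links* (1976), §9.F (the surgered manifold near the new solid torus).
[cite: Rolfsen1976, §9.F] -/
theorem exists_surgeredTube (hφ : Manifold.IsSmoothEmbedding (𝓡 3) (𝓡 3) ∞ φ)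
    (hφo : IsOpen (range φ))
    (hψ : Manifold.IsSmoothEmbedding (𝓘(ℝ, 𝔼 2).prod (𝓡 1)) (𝓡 3) ∞ ψ) (hψo : IsOpen (range ψ))
    (hrel : ∀ a c, φ a = ψ c ↔ surgeryRel μ a c) :
    ∃ Ψ : TubeNbhd (𝓡 3) (fun v : 𝕊 1 ↦ ψ ⟨((0 : 𝔼 2), v), by simp⟩),
      (∀ c : solidTorus, Ψ.toFun ((c : (𝔼 2) × (𝕊 1)).2, (c : (𝔼 2) × (𝕊 1)).1) = ψ c) ∧
      ∀ (x : 𝕊 1) (w : 𝔼 2) (hw : w ≠ 0),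
        Ψ.toFun (radialProjection (spherePt 1) w, ‖w‖ • (x : 𝔼 2)) =
          φ ⟨μ (x, w), μ.apply_mem_compl_range hw⟩ := by
  have hL₁ : ((𝔼 2) × (𝔼 1)) ≃L[ℝ] ((𝔼 1) × (𝔼 2)) := ContinuousLinearEquiv.prodComm ℝ (𝔼 2) (𝔼 1)
  have hL₂ : ((𝔼 1) × (𝔼 2)) ≃L[ℝ] 𝔼 3 := hL₁.symm.trans solidTorusModelIso
  /- the model side: the image of `μ` (an open subset of `S³`, so that both gluings are modelled
  on `ℝ³`) as a gluing of the punctured bundle and the open solid torus -/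
  set P : TopologicalSpace.Opens (𝕊 3) := ⟨range ⇑μ, μ.isOpen_range⟩ with hP
  have hμP : ∀ q, μ q ∈ P := fun q ↦ mem_range_self q
  obtain ⟨hμc, hμco⟩ := isSmoothEmbedding_codRestrict_opens μ.isSmoothEmbedding_coe μ.isOpen_range
    P hμP hL₂
  set μc : (𝕊 1) × (𝔼 2) → P := fun q ↦ ⟨μ q, hμP q⟩ with hμc_def
  -- first piece: `μ ∘ polarSwap`
  set jA₀ : puncturedBundle → P := μc ∘ Subtype.val ∘ polarSwap with hjA₀
  have hvalps : Manifold.IsSmoothEmbedding ((𝓡 1).prod 𝓘(ℝ, 𝔼 2)) ((𝓡 1).prod 𝓘(ℝ, 𝔼 2)) ∞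
      ((Subtype.val : puncturedBundle → (𝕊 1) × (𝔼 2)) ∘ polarSwap) :=
    isSmoothEmbedding_comp_diffeomorph (Manifold.IsSmoothEmbedding.of_opens puncturedBundle)
      polarSwap
  have hvalps_range : range ((Subtype.val : puncturedBundle → (𝕊 1) × (𝔼 2)) ∘ polarSwap) =
      {q | q.2 ≠ 0} := by
    rw [(EquivLike.surjective polarSwap).range_comp, Subtype.range_coe]; rfl
  have hvalps_o : IsOpen (range ((Subtype.val : puncturedBundle → (𝕊 1) × (𝔼 2)) ∘ polarSwap)) := by
    rw [hvalps_range]; exact puncturedBundle.isOpen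
  obtain ⟨hjA₀emb, hjA₀o⟩ := isSmoothEmbedding_comp_of_isOpen_range hμc hμco hvalps hvalps_o
    hL₂
  -- second piece: `μ ∘ swap`
  set swapD := Diffeomorph.prodComm 𝓘(ℝ, 𝔼 2) (𝓡 1) (𝔼 2) (𝕊 1) ∞ with hswapD
  have hswap : Manifold.IsSmoothEmbedding (𝓘(ℝ, 𝔼 2).prod (𝓡 1)) ((𝓡 1).prod 𝓘(ℝ, 𝔼 2)) ∞
      (swapD : (𝔼 2) × (𝕊 1) → (𝕊 1) × (𝔼 2)) :=
    isSmoothEmbedding_diffeomorph_of_boundaryless swapD hL₁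
  have hswapo : IsOpen (range (swapD : (𝔼 2) × (𝕊 1) → (𝕊 1) × (𝔼 2))) := by
    rw [(EquivLike.surjective swapD).range_eq]; exact isOpen_univ
  obtain ⟨hsv, hsvo⟩ := isSmoothEmbedding_comp_of_isOpen_range hswap hswapo
    (Manifold.IsSmoothEmbedding.of_opens solidTorus) (by rw [Subtype.range_coe]; exact solidTorus.isOpen)
    hL₁
  set jB₀ : solidTorus → P := μc ∘ (swapD : (𝔼 2) × (𝕊 1) → (𝕊 1) × (𝔼 2)) ∘ Subtype.val
    with hjB₀
  obtain ⟨hjB₀emb, hjB₀o⟩ := isSmoothEmbedding_comp_of_isOpen_range hμc hμco hsv hsvo solidTorusModelIso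
  have hjA₀val : ∀ a : puncturedBundle, jA₀ a = ⟨μ (polarSwapFun a), hμP _⟩ := fun a ↦ rfl
  have hjB₀val : ∀ c : solidTorus,
      jB₀ c = ⟨μ ((c : (𝔼 2) × (𝕊 1)).2, (c : (𝔼 2) × (𝕊 1)).1), hμP _⟩ := fun c ↦ rfl
  have hcov₀ : range jA₀ ∪ range jB₀ = univ := by
    refine eq_univ_of_forall fun y ↦ ?_
    obtain ⟨⟨v, p⟩, hq⟩ := y.2
    by_cases hp : p = 0
    · refine Or.inr ⟨⟨(p, v), by simp [hp]⟩, Subtype.ext ?_⟩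
      rw [hjB₀val]; exact hq
    · refine Or.inl ⟨polarSwap ⟨(v, p), hp⟩, Subtype.ext ?_⟩
      rw [hjA₀val, coe_polarSwap_apply, polarSwapFun_polarSwapFun hp]
      exact hq
  -- the manifold side: the corresponding open subset of `Y`
  set μA : puncturedBundle → K.complement :=
    fun q ↦ ⟨μ (q : (𝕊 1) × (𝔼 2)), μ.apply_mem_complement_of_mem_puncturedBundle q⟩ with hμA
  have hμval : Manifold.IsSmoothEmbedding ((𝓡 1).prod 𝓘(ℝ, 𝔼 2)) (𝓡 3) ∞
      (⇑μ ∘ (Subtype.val : puncturedBundle → (𝕊 1) × (𝔼 2))) ∧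
      IsOpen (range (⇑μ ∘ (Subtype.val : puncturedBundle → (𝕊 1) × (𝔼 2)))) :=
    isSmoothEmbedding_comp_of_isOpen_range μ.isSmoothEmbedding_coe μ.isOpen_range
      (Manifold.IsSmoothEmbedding.of_opens puncturedBundle)
      (by rw [Subtype.range_coe]; exact puncturedBundle.isOpen) hL₂
  obtain ⟨hμA, hμAo⟩ := isSmoothEmbedding_codRestrict_opens hμval.1 hμval.2 K.complement
    (fun q ↦ μ.apply_mem_complement_of_mem_puncturedBundle q) hL₂
  obtain ⟨hjA₁, hjA₁o⟩ := isSmoothEmbedding_comp_of_isOpen_range hφ hφo hμA hμAo hL₂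
  set R : TopologicalSpace.Opens Y := ⟨range (φ ∘ μA) ∪ range ψ, hjA₁o.union hψo⟩ with hR
  have hAR : ∀ q, (φ ∘ μA) q ∈ R := fun q ↦ Or.inl (mem_range_self q)
  have hBR : ∀ c, ψ c ∈ R := fun c ↦ Or.inr (mem_range_self c)
  obtain ⟨hjA, hjAo⟩ := isSmoothEmbedding_codRestrict_opens hjA₁ hjA₁o R hAR hL₂
  obtain ⟨hjB, hjBo⟩ := isSmoothEmbedding_codRestrict_opens hψ hψo R hBR solidTorusModelIso
  have hcov : range (fun q ↦ (⟨(φ ∘ μA) q, hAR q⟩ : R)) ∪ range (fun c ↦ (⟨ψ c, hBR c⟩ : R)) =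
      univ := by
    refine eq_univ_of_forall fun y ↦ ?_
    rcases y.2 with ⟨q, hq⟩ | ⟨c, hc⟩
    · exact Or.inl ⟨q, Subtype.ext hq⟩
    · exact Or.inr ⟨c, Subtype.ext hc⟩
  -- the two relations agree
  have hrel₀ : ∀ (a : puncturedBundle) (c : solidTorus),
      jA₀ a = jB₀ c ↔ (⟨(φ ∘ μA) a, hAR a⟩ : R) = ⟨ψ c, hBR c⟩ := by
    intro a c
    rw [hjA₀val, hjB₀val]
    simp only [Subtype.mk.injEq]
    rw [μ.injective.eq_iff, comp_apply, hrel]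
    change polarSwapFun a = _ ↔ μ.glueRel (μ (a : (𝕊 1) × (𝔼 2))) c
    obtain ⟨⟨x, w⟩, hw⟩ := a
    change w ≠ 0 at hw
    have hwpos : 0 < ‖w‖ := norm_pos_iff.2 hw
    simp only [polarSwapFun, TubeNbhd.polar, Prod.swap, Prod.mk.injEq]
    constructor
    · rintro ⟨hv, hp⟩
      refine ⟨x, ‖w‖, ⟨hwpos, ?_⟩, hp.symm, ?_⟩
      · have := (mem_solidTorus_iff _).1 c.2
        rwa [← hp, norm_smul_coe_sphere (norm_nonneg _)] at this
      · rw [← hv, norm_smul_coe_radialProjection]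
    · rintro ⟨u, t, ht, hp, ha⟩
      have ha' := μ.injective ha
      simp only [Prod.mk.injEq] at ha'
      obtain ⟨rfl, rfl⟩ := ha'
      refine ⟨radialProjection_smul _ ht.1 _, ?_⟩
      rw [norm_smul_coe_sphere ht.1.le, hp]
  obtain ⟨Θ, hΘA, hΘB⟩ := exists_diffeomorph_comp_eq_of_gluings
    (IP := 𝓡 3) (IP' := 𝓡 3) (P := P) (P' := R) hjA₀emb hjA₀o hjB₀emb hjB₀o hcov₀
    hjA hjAo hjB hjBo hcov hrel₀
  -- the tube
  set Ψ : (𝕊 1) × (𝔼 2) → Y := Subtype.val ∘ Θ ∘ μc with hΨ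
  have hΘμ : Manifold.IsSmoothEmbedding ((𝓡 1).prod 𝓘(ℝ, 𝔼 2)) (𝓡 3) ∞ (Θ ∘ μc) :=
    hμc.diffeomorph_comp Θ
  have hΘμo : IsOpen (range (Θ ∘ μc)) := by
    rw [range_comp]
    have := Θ.toHomeomorph.isOpenMap _ hμco
    rwa [Diffeomorph.coe_toHomeomorph] at this
  obtain ⟨hΨemb, -⟩ := isSmoothEmbedding_comp_of_isOpen_range
    (Manifold.IsSmoothEmbedding.of_opens R) (by rw [Subtype.range_coe]; exact R.isOpen) hΘμ hΘμo hL₂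
  have hΨB : ∀ c : solidTorus, Ψ ((c : (𝔼 2) × (𝕊 1)).2, (c : (𝔼 2) × (𝕊 1)).1) = ψ c := fun c ↦ by
    have : μc ((c : (𝔼 2) × (𝕊 1)).2, (c : (𝔼 2) × (𝕊 1)).1) = jB₀ c := rfl
    rw [hΨ, comp_apply, comp_apply, this, hΘB]
  have hΨA : ∀ (x : 𝕊 1) (w : 𝔼 2) (hw : w ≠ 0),
      Ψ (radialProjection (spherePt 1) w, ‖w‖ • (x : 𝔼 2)) =
        φ ⟨μ (x, w), μ.apply_mem_compl_range hw⟩ := fun x w hw ↦ by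
    have : μc (radialProjection (spherePt 1) w, ‖w‖ • (x : 𝔼 2)) = jA₀ ⟨(x, w), hw⟩ := rfl
    rw [hΨ, comp_apply, comp_apply, this, hΘA]
    rfl
  exact ⟨{ toFun := Ψ,
            isSmoothEmbedding := hΨemb,
            isOpen_range := (TubeNbhd.ofEmbedding Ψ hΨemb).isOpen_range,
            apply_zero := fun v ↦ hΨB ⟨((0 : 𝔼 2), v), by simp⟩ }, hΨB, hΨA⟩

end SurgeredTube

/-! ## Re-presenting a knot surgery: thinner solid torus, conjugated complement -/

section Represent

variable {K : Knot} (νⱼ : Knot.TubularNbhd K)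
  {Yⱼ : Type*} [TopologicalSpace Yⱼ] [ChartedSpace (𝔼 3) Yⱼ] [IsManifold (𝓡 3) ∞ Yⱼ]
  {φ : K.complement → Yⱼ} {ψ : solidTorus → Yⱼ}

omit [IsManifold (𝓡 3) ∞ Yⱼ] in
/-- **Shrinking the solid torus of a knot surgery presentation keeps the embedding of the
complement.** If `Yⱼ` is presented as surgery on `K` with the tube `νⱼ` by gluing maps `φ`, `ψ`,
then for `0 < r ≤ 1` it is presented with the rescaled tube `νⱼ.scale r` (`(x, w) ↦ νⱼ (x, r w)`,
same image, same framing) by the *same* `φ` and the solid torus `ψ ∘ (p, v) ↦ (r p, v)`: the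
annulus `ψ {r ≤ ‖p‖ < 1}` is covered by the complement. Single-knot form of the tree's
`Link.IsSurgeryPresentation.scale` (`KirbyMovesShrinkProofs.lean`). Rolfsen, *Knots and Links*
(1976), §9.F; Kosinski (1993), III.(3.4). [cite: Rolfsen1976, §9.F] -/
theorem exists_presentation_scale
    (hψ : Manifold.IsSmoothEmbedding (𝓘(ℝ, 𝔼 2).prod (𝓡 1)) (𝓡 3) ∞ ψ) (hψo : IsOpen (range ψ))
    (hcov : range φ ∪ range ψ = univ) (hrel : ∀ a c, φ a = ψ c ↔ surgeryRel νⱼ a c)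
    {r : ℝ} (hr : 0 < r) (hr1 : r ≤ 1) :
    ∃ ψ' : solidTorus → Yⱼ,
      Manifold.IsSmoothEmbedding (𝓘(ℝ, 𝔼 2).prod (𝓡 1)) (𝓡 3) ∞ ψ' ∧ IsOpen (range ψ') ∧
      range φ ∪ range ψ' = univ ∧ (∀ a c, φ a = ψ' c ↔ surgeryRel (νⱼ.scale r hr) a c) ∧
      ∀ c, ψ' c = ψ (solidTorusScale r hr hr1 c) := by
  set Φ : OpenPartialHomeomorph solidTorus solidTorus := solidTorusScale r hr hr1 with hΦ
  refine ⟨ψ ∘ Φ, ?_, ?_, ?_, fun a b ↦ ?_, fun c ↦ rfl⟩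
  · exact hψ.comp_openPartialHomeomorph Φ rfl (contMDiff_solidTorusScale _ _ _).contMDiffOn
      (contMDiffOn_solidTorusScale_symm _ _ _)
  · rw [hΦ, range_comp_solidTorusScale]
    exact (Topology.IsOpenEmbedding.mk hψ.isEmbedding hψo).isOpenMap _
      (solidTorusScale r hr hr1).open_target
  · refine eq_univ_of_forall fun y ↦ ?_
    rcases eq_univ_iff_forall.1 hcov y with hy | ⟨b, rfl⟩
    · exact Or.inl hy
    · by_cases hbr : ‖(b : (𝔼 2) × (𝕊 1)).1‖ < r
      · refine Or.inr ⟨Φ.symm b, ?_⟩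
        change ψ (Φ (Φ.symm b)) = ψ b
        rw [Φ.right_inv (show b ∈ Φ.target from hbr)]
      · refine Or.inl ?_
        set p : 𝔼 2 := (b : (𝔼 2) × (𝕊 1)).1 with hp
        set v : 𝕊 1 := (b : (𝔼 2) × (𝕊 1)).2 with hv
        have hp1 : ‖p‖ < 1 := (mem_solidTorus_iff _).1 b.2
        have hp0 : 0 < ‖p‖ := hr.trans_le (not_lt.1 hbr)
        set t : ℝ := ‖p‖ with ht
        have hu1 : t⁻¹ • p ∈ Metric.sphere (0 : 𝔼 2) 1 := by
          rw [mem_sphere_zero_iff_norm, norm_smul, norm_inv, Real.norm_of_nonneg hp0.le, ← ht,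
            inv_mul_cancel₀ hp0.ne']
        set u : 𝕊 1 := ⟨t⁻¹ • p, hu1⟩ with hu
        have hpu : p = t • (u : 𝔼 2) := by
          change p = t • (t⁻¹ • p)
          rw [smul_inv_smul₀ hp0.ne']
        have ha₀ : νⱼ (u, t • (v : 𝔼 2)) ∈ K.complement :=
          νⱼ.apply_mem_compl_range (smul_ne_zero hp0.ne' (ne_zero_of_mem_unit_sphere v))
        refine ⟨⟨νⱼ (u, t • (v : 𝔼 2)), ha₀⟩, ?_⟩
        rw [hrel]
        exact ⟨u, t, ⟨hp0, hp1⟩, hpu, rfl⟩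
  · change φ a = ψ (Φ b) ↔ _
    rw [hrel a (Φ b)]
    change νⱼ.glueRel (a : 𝕊 3) ((Φ b : solidTorus) : (𝔼 2) × (𝕊 1)) ↔
      (νⱼ.scale r hr).glueRel (a : 𝕊 3) (b : (𝔼 2) × (𝕊 1))
    rw [hΦ, coe_solidTorusScale_apply, νⱼ.glueRel_scale_iff hr hr1 _ ((mem_solidTorus_iff _).1 b.2)]

omit [IsManifold (𝓡 3) ∞ Yⱼ] in
/-- **Conjugating the embedding of the complement by a diffeomorphism matching two tubes.** If
`Yⱼ` is presented as surgery on `K` with the tube `ν₁` by gluing maps `φ`, `ψ`, and `F` is a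
diffeomorphism of `S³` with `F (ν₂ (x, w)) = ν₁ (x, w)` for `‖w‖ < 1` (so fixing `K` pointwise), then
`Yⱼ` is presented with the tube `ν₂` by `φ ∘ F` (restricted to the complement) and the same
`ψ`. With the framed uniqueness of tubular neighbourhoods (`Knot.TubularNbhd.framedUniqueness_holds`)
this re-presents a surgery with any tube of the right framing (the tree's
`IsIntegralSurgery.exists_presentation'`, here keeping track of `F`). Rolfsen (1976), §9.F.
[cite: Rolfsen1976, §9.F] -/
theorem exists_presentation_conj {ν₁ : Knot.TubularNbhd K}
    (hφ : Manifold.IsSmoothEmbedding (𝓡 3) (𝓡 3) ∞ φ) (hφo : IsOpen (range φ))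
    (hcov : range φ ∪ range ψ = univ) (hrel : ∀ a c, φ a = ψ c ↔ surgeryRel ν₁ a c)
    (ν₂ : Knot.TubularNbhd K) (F : (𝕊 3) ≃ₘ⟮𝓡 3, 𝓡 3⟯ (𝕊 3))
    (hF : ∀ (x : 𝕊 1) (w : 𝔼 2), ‖w‖ < 1 → F (ν₂ (x, w)) = ν₁ (x, w)) :
    ∃ (hmem : ∀ a : 𝕊 3, a ∈ K.complement ↔ F a ∈ K.complement),
      Manifold.IsSmoothEmbedding (𝓡 3) (𝓡 3) ∞
        (φ ∘ F.restrOpens K.complement K.complement hmem) ∧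
      IsOpen (range (φ ∘ F.restrOpens K.complement K.complement hmem)) ∧
      range (φ ∘ F.restrOpens K.complement K.complement hmem) ∪ range ψ = univ ∧
      ∀ a c, (φ ∘ F.restrOpens K.complement K.complement hmem) a = ψ c ↔ surgeryRel ν₂ a c := by
  -- `F` fixes the knot: `F (K x) = F (ν₂ (x, 0)) = ν₁ (x, 0) = K x`
  have hFK : ∀ x, F (K x) = K x := fun x ↦ by
    rw [← ν₂.coe_apply_zero x, hF x 0 (by simp), ν₁.coe_apply_zero, ν₂.coe_apply_zero]
  have hmem : ∀ a : 𝕊 3, a ∈ K.complement ↔ F a ∈ K.complement := fun a ↦ by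
    simp only [SphereEmbedding.mem_complement_iff, mem_range, not_exists]
    refine forall_congr' fun y ↦ not_congr ⟨fun h ↦ ?_, fun h ↦ ?_⟩
    · rw [← h, hFK]
    · exact F.injective ((hFK y).trans h)
  set e := F.restrOpens K.complement K.complement hmem with he
  refine ⟨hmem, isSmoothEmbedding_comp_diffeomorph hφ e, ?_, ?_, fun a c ↦ ?_⟩
  · rw [(EquivLike.surjective e).range_comp]; exact hφo
  · rw [(EquivLike.surjective e).range_comp]; exact hcov
  · rw [comp_apply, hrel]
    change ν₁.glueRel (F a) c ↔ ν₂.glueRel a c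
    constructor
    · rintro ⟨u, t, ht, hb, ha⟩
      refine ⟨u, t, ht, hb, F.injective ?_⟩
      change F a = F _
      rw [ha, hF u _ (norm_smul_coe_sphere_lt_one ht _)]
    · rintro ⟨u, t, ht, hb, ha⟩
      refine ⟨u, t, ht, hb, ?_⟩
      rw [ha, hF u _ (norm_smul_coe_sphere_lt_one ht _)]

end Represent

end Literature.Topology.FourManifolds
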